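import Literature.Probability.LatticeModels.MedialInterfaceProofs
import HarnessLib

/-!
# Discrete Dobrushin data from a finite set of lattice sites

Topic `Literature/Probability/LatticeModels`. The tree encodes discrete Dobrushin domains on `δℤ²`
through *continuum* data `D : DiscreteDobrushin` (a planar domain `Ω`, a mesh `δ` and two
boundary arcs, `LatticeInterface.lean` / `MedialInterface.lean`), from which the lattice objects
consumed by the FK-Ising observable machinery (`meshDomain`, `discreteDomainGraph`,
`DiscreteDobrushin.IsInnerFace`, `zdBoundary`, `zdArcA`, `zdArcB`, `IsZdAdmissible`, …) are
derived. The Russo–Seymour–Welsh programme of Duminil-Copin–Hongler–Nolin (arXiv:0912.4253, §§3–4)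
works instead with *combinatorial* Dobrushin domains: a finite set of sites of `ℤ²` (rectangles,
rectangles with a wired bar or a wired needle, …) with a prescribed wired part of its boundary.
This file realises any such combinatorial datum as continuum data and computes all the derived
lattice objects, so that the observable machinery applies verbatim to lattice domains.

Construction (mesh `δ = 1`). For a set of sites `S ⊆ ℤ²` let `siteDomain S ⊆ ℂ` be the set of
points all of whose sup-norm-closest lattice points (`SupClose z x`: `‖z - x‖_∞ ≤ 1/2`) lie in `S`
— the interior of the union of the closed unit squares centred at the sites of `S`. For `A ⊆ S`
(the sites to be wired) the arc `A` is the union `exposedSides S A` of the sides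
`sideSeg a c = {z | SupClose z a ∧ SupClose z c}` of the squares of sites `a ∈ A` facing lattice
neighbours `c ∉ S`, and the arc `B` is the rest of the frontier.

Main results (everything proved, [folklore] lattice bookkeeping):

* the combinatorial datum `LatticeDobrushin` (`S`, `A ⊆ S`, finite, lattice-connected) and its
  realisation `LatticeDobrushin.toDobrushin`; `meshVertices_siteDomain`,
  `LatticeDobrushin.meshDomain_eq` (the discrete domain is `S`), `LatticeDobrushin.adj_iff` (the
  domain graph is `ℤ²` induced on `S`), `LatticeDobrushin.isInnerFace_iff` (a face is inner iff its
  four corners lie in `S`), `LatticeDobrushin.mem_meshBoundary_iff`,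
  `LatticeDobrushin.not_mem_zdBoundary_of_forall` (sites with all eight neighbours in `S` are not
  boundary sites), `isOpen_siteDomain`, `isBounded_siteDomain`;
* the metric lemmas behind the arcs: `frontier_siteDomain_subset` (the frontier consists of
  exposed sides), `sideSeg_subset_frontier`, `sqrt_two_div_two_le_dist_of_mem_sideSeg` (a lattice
  point off an edge is at distance `≥ √2/2` from the side dual to it), whence **no ties at exposed
  sites**: `mem_zdArcA_of_exposed`, `not_mem_zdArcB_of_exposed`, `mem_zdArcB_of_exposed`,
  `not_mem_zdArcA_of_exposed`; the concave-corner versions `mem_zdArcA_of_flanks`,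
  `mem_zdArcB_of_flanks` (`isFlank_of_dist_lt`: the frontier within `3/2` of a site without exposed
  side); for domains whose sites are all regular or exposed the arcs in closed form (`zdBoundary_eq`,
  `zdArcA_eq`, `zdArcB_eq`, `disjoint_zdArcA_zdArcB`, `mem_zdABEdges_iff`) and the admissibility
  constructor `isZdAdmissible_of`.

What is NOT here: the instantiations (rectangles with a wired bar, three-sided boxes, needle
domains), hole-freeness of their inner faces and the connectivity of their wired arcs — these are
domain-specific and live with their users.

## References

* H. Duminil-Copin, C. Hongler, P. Nolin, *Connection probabilities and RSW-type bounds for the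
  two-dimensional FK Ising model*, Comm. Pure Appl. Math. 64 (2011) 1165–1198, §2.2 ("FK Ising
  model in Dobrushin domains": finite subgraphs of `ℤ²` with a boundary arc split) — bib key
  `DuminilCopinHonglerNolin2011`.
* S. Smirnov, *Conformal invariance in random cluster models. I*, Ann. of Math. 172 (2010), §2.1.
-/

noncomputable section

namespace Literature.Probability.LatticeModels

open Complex Metric Set

/-! ### Sup-norm closeness and the site-square domain -/

/-- The real coordinates of a complex number, indexed like the sites of `ℤ²`. [folklore] -/
def coordC (z : ℂ) : Fin 2 → ℝ := ![z.re, z.im]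

/-- The first coordinate is the real part. [folklore] -/
@[simp] theorem coordC_zero (z : ℂ) : coordC z 0 = z.re := rfl

/-- The second coordinate is the imaginary part. [folklore] -/
@[simp] theorem coordC_one (z : ℂ) : coordC z 1 = z.im := rfl

/-- The coordinates of a lattice point. [folklore] -/
@[simp] theorem coordC_toComplex (x : Site 2) (i : Fin 2) : coordC (Site.toComplex x) i = x i := by
  fin_cases i <;> simp [coordC, Site.toComplex]

/-- Two complex numbers with the same coordinates are equal. [folklore] -/
theorem ext_of_coordC {z w : ℂ} (h : ∀ i, coordC z i = coordC w i) : z = w :=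
  Complex.ext (h 0) (h 1)

/-- `coordC` is additive. [folklore] -/
@[simp] theorem coordC_add (z w : ℂ) (i : Fin 2) : coordC (z + w) i = coordC z i + coordC w i := by
  fin_cases i <;> simp [coordC]

/-- `coordC` commutes with subtraction. [folklore] -/
@[simp] theorem coordC_sub (z w : ℂ) (i : Fin 2) : coordC (z - w) i = coordC z i - coordC w i := by
  fin_cases i <;> simp [coordC]

/-- `coordC` commutes with real scalar multiplication. [folklore] -/
@[simp] theorem coordC_smul (t : ℝ) (z : ℂ) (i : Fin 2) : coordC (t • z) i = t * coordC z i := by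
  fin_cases i <;> simp [coordC]

/-- The squared distance of two complex numbers in coordinates. [folklore] -/
theorem dist_sq_eq_sum_coordC (z w : ℂ) :
    dist z w ^ 2 = (coordC z 0 - coordC w 0) ^ 2 + (coordC z 1 - coordC w 1) ^ 2 := by
  rw [Complex.dist_eq, Complex.sq_norm, Complex.normSq_apply]
  simp [coordC, sq]

/-- A coordinate difference is bounded by the distance. [folklore] -/
theorem abs_coordC_sub_le_dist (z w : ℂ) (i : Fin 2) : |coordC z i - coordC w i| ≤ dist z w := by
  fin_cases i
  · simpa [coordC, Complex.dist_eq] using Complex.abs_re_le_norm (z - w)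
  · simpa [coordC, Complex.dist_eq] using Complex.abs_im_le_norm (z - w)

/-- The mesh point at mesh `1` is the plain embedding of `ℤ²` in `ℂ`. [folklore] -/
@[simp] theorem meshPoint_one (x : Site 2) : meshPoint 1 x = Site.toComplex x := by
  simp [meshPoint]

/-- `z` is *sup-close* to the lattice point `x`: `‖z - x‖_∞ ≤ 1/2`, i.e. `z` lies in the closed unit
square centred at `x`. [folklore] -/
def SupClose (z : ℂ) (x : Site 2) : Prop := ∀ i : Fin 2, |coordC z i - x i| ≤ 1 / 2

/-- A lattice point is sup-close to a lattice point iff they are equal. [folklore] -/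
theorem supClose_toComplex_iff {x y : Site 2} : SupClose (Site.toComplex y) x ↔ x = y := by
  constructor
  · intro h
    funext i
    have hi := h i
    rw [coordC_toComplex] at hi
    have h1 : |((y i - x i : ℤ) : ℝ)| ≤ 1 / 2 := by push_cast; exact hi
    have h2 : |y i - x i| < 1 := by
      have : ((|y i - x i| : ℤ) : ℝ) < 1 := by rw [Int.cast_abs]; linarith
      exact_mod_cast this
    have := abs_lt.mp h2
    omega
  · rintro rfl i
    simp

/-- Every point of the plane is sup-close to some lattice point (round the coordinates). [folklore] -/
theorem exists_supClose (z : ℂ) : ∃ x : Site 2, SupClose z x := by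
  refine ⟨![round z.re, round z.im], fun i => ?_⟩
  fin_cases i
  · simpa [coordC] using abs_sub_round z.re
  · simpa [coordC] using abs_sub_round z.im

/-- Two lattice points sup-close to the same point differ by at most one in each coordinate. [folklore] -/
theorem abs_sub_le_one_of_supClose {z : ℂ} {x y : Site 2} (hx : SupClose z x) (hy : SupClose z y)
    (i : Fin 2) : |x i - y i| ≤ 1 := by
  have h1 := hx i
  have h2 := hy i
  have : |((x i : ℝ)) - (y i : ℝ)| ≤ 1 := by
    rw [abs_le] at h1 h2 ⊢; constructor <;> linarith
  exact_mod_cast this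

/-- **The site-square domain** of a set of sites `S ⊆ ℤ²`: the points of the plane all of whose
sup-close lattice points lie in `S` — the interior of the union of the closed unit squares centred
at the sites of `S` (a "polyomino" drawn on the dual lattice). Taken at mesh `δ = 1`, its set of
mesh vertices is exactly `S` and its mesh graph is `ℤ²` induced on `S`. [folklore] -/
def siteDomain (S : Set (Site 2)) : Set ℂ := {z | ∀ x, SupClose z x → x ∈ S}

variable {S : Set (Site 2)}

/-- Membership in `siteDomain`, unfolded. [folklore] -/
theorem mem_siteDomain_iff {z : ℂ} : z ∈ siteDomain S ↔ ∀ x, SupClose z x → x ∈ S := Iff.rfl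

/-- A lattice point lies in the site-square domain iff it is a site of `S`. [folklore] -/
theorem toComplex_mem_siteDomain_iff {x : Site 2} : Site.toComplex x ∈ siteDomain S ↔ x ∈ S := by
  constructor
  · intro h
    exact h x (supClose_toComplex_iff.2 rfl)
  · intro hx y hy
    rwa [supClose_toComplex_iff.1 hy]

/-- **The mesh vertices of the site-square domain are the sites of `S`.** [folklore] -/
theorem meshVertices_siteDomain (S : Set (Site 2)) : meshVertices (siteDomain S) 1 = S := by
  ext x
  rw [mem_meshVertices_iff, meshPoint_one, toComplex_mem_siteDomain_iff]

/-- The site-square domain of a bounded-above/below set of sites is bounded: it lies in the ball of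
radius `R + 1` as soon as all sites of `S` have coordinates bounded by `R` in absolute value. [folklore] -/
theorem siteDomain_subset_closedBall {R : ℝ} (hR : ∀ x ∈ S, ∀ i, |(x i : ℝ)| ≤ R) :
    siteDomain S ⊆ closedBall (0 : ℂ) (2 * (R + 1)) := by
  intro z hz
  obtain ⟨x, hx⟩ := exists_supClose z
  have hxS := hz x hx
  rw [mem_closedBall, dist_zero_right]
  have h0 : |z.re| ≤ R + 1 := by
    have := hx 0; have := hR x hxS 0
    simp only [coordC_zero] at *
    rw [abs_le] at *; constructor <;> linarith
  have h1 : |z.im| ≤ R + 1 := by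
    have := hx 1; have := hR x hxS 1
    simp only [coordC_one] at *
    rw [abs_le] at *; constructor <;> linarith
  calc ‖z‖ ≤ |z.re| + |z.im| := Complex.norm_le_abs_re_add_abs_im z
    _ ≤ 2 * (R + 1) := by linarith

/-- The site-square domain of a finite set of sites is bounded. [folklore] -/
theorem isBounded_siteDomain (hS : S.Finite) : Bornology.IsBounded (siteDomain S) := by
  obtain ⟨R, hR⟩ : ∃ R : ℝ, ∀ x ∈ S, ∀ i, |(x i : ℝ)| ≤ R := by
    have hfin : (S.image fun x : Site 2 => max |(x 0 : ℝ)| |(x 1 : ℝ)|).Finite := hS.image _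
    obtain ⟨R, hR⟩ := hfin.bddAbove
    refine ⟨R, fun x hx i => ?_⟩
    have := hR (Set.mem_image_of_mem _ hx)
    fin_cases i
    · exact (le_max_left _ _).trans this
    · exact (le_max_right _ _).trans this
  exact (isBounded_closedBall).subset (siteDomain_subset_closedBall hR)

/-! ### Segments between neighbouring sites -/

/-- A point of the segment between two neighbouring sites of `ℤ²` is sup-close only to its two
endpoints. [folklore] -/
theorem eq_or_eq_of_supClose_of_mem_segment {x : Site 2} {i : Fin 2} {z : ℂ}
    (hz : z ∈ segment ℝ (Site.toComplex x) (Site.toComplex (x + Pi.single i 1))) {w : Site 2}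
    (hw : SupClose z w) : w = x ∨ w = x + Pi.single i 1 := by
  rw [segment_eq_image'] at hz
  obtain ⟨t, ⟨ht0, ht1⟩, rfl⟩ := hz
  -- coordinates of the point
  have hc : ∀ j, coordC (Site.toComplex x + t • (Site.toComplex (x + Pi.single i 1) - Site.toComplex x)) j =
      x j + t * (if j = i then 1 else 0) := by
    intro j
    simp only [coordC_add, coordC_smul, coordC_sub, coordC_toComplex, Pi.add_apply, Pi.single_apply]
    split_ifs <;> push_cast <;> ring
  have key : ∀ j, j ≠ i → w j = x j := by
    intro j hj
    have h := hw j
    rw [hc j, if_neg hj, mul_zero, add_zero] at h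
    have : |((x j - w j : ℤ) : ℝ)| ≤ 1 / 2 := by push_cast; exact h
    have h2 : |x j - w j| < 1 := by
      have : ((|x j - w j| : ℤ) : ℝ) < 1 := by rw [Int.cast_abs]; linarith
      exact_mod_cast this
    have := abs_lt.mp h2
    omega
  have hi := hw i
  rw [hc i, if_pos rfl, mul_one] at hi
  have hwi : w i = x i ∨ w i = x i + 1 := by
    rw [abs_le] at hi
    obtain ⟨h1, h2⟩ := hi
    have h3 : (x i : ℝ) - 1 < w i := by linarith
    have h4 : (w i : ℝ) < x i + 2 := by linarith
    have h3' : x i - 1 < w i := by exact_mod_cast h3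
    have h4' : w i < x i + 2 := by exact_mod_cast h4
    omega
  rcases hwi with h | h
  · left
    funext j
    by_cases hj : j = i
    · subst hj; exact h
    · exact key j hj
  · right
    funext j
    by_cases hj : j = i
    · subst hj; simp [h]
    · simp [Pi.single_apply, if_neg hj, key j hj]

/-- The segment between two neighbouring sites of `S` lies in the site-square domain. [folklore] -/
theorem segment_subset_siteDomain {x : Site 2} {i : Fin 2} (hx : x ∈ S) (hy : x + Pi.single i 1 ∈ S) :
    segment ℝ (Site.toComplex x) (Site.toComplex (x + Pi.single i 1)) ⊆ siteDomain S := by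
  intro z hz w hw
  rcases eq_or_eq_of_supClose_of_mem_segment hz hw with rfl | rfl
  · exact hx
  · exact hy

/-- **The mesh graph of the site-square domain is `ℤ²` induced on `S`**: two sites of `S` that are
neighbours in `ℤ²` are joined (the segment between them lies in the domain). [folklore] -/
theorem meshGraph_siteDomain_adj {x y : Site 2} (hx : x ∈ S) (hy : y ∈ S) (h : (zdGraph 2).Adj x y) :
    (meshGraph (siteDomain S) 1).Adj x y := by
  refine meshGraph_adj_iff.2 ⟨h, ?_⟩
  rw [meshPoint_one, meshPoint_one]
  obtain ⟨i, hi | hi⟩ := (zdGraph_adj_iff x y).1 h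
  · subst hi
    exact (segment_subset_siteDomain hx hy).trans subset_closure
  · subst hi
    rw [segment_symm]
    exact (segment_subset_siteDomain hy hx).trans subset_closure

/-! ### Lattice connectivity and the discrete domain -/

/-- A step of a nearest-neighbour lattice walk inside `S`. [folklore] -/
def SiteStep (S : Set (Site 2)) (a b : Site 2) : Prop := (zdGraph 2).Adj a b ∧ a ∈ S ∧ b ∈ S

/-- Lattice walks inside `S` give walks in the mesh vertex graph of the site-square domain. [folklore] -/
theorem reachable_of_reflTransGen {x : Site 2} (hx : x ∈ meshVertices (siteDomain S) 1) {y : Site 2}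
    (h : Relation.ReflTransGen (SiteStep S) x y) (hy : y ∈ meshVertices (siteDomain S) 1) :
    (meshVertexGraph (siteDomain S) 1).Reachable ⟨x, hx⟩ ⟨y, hy⟩ := by
  induction h with
  | refl => exact SimpleGraph.Reachable.refl _
  | @tail b c _ hbc ih =>
    have hb : b ∈ meshVertices (siteDomain S) 1 := by rw [meshVertices_siteDomain]; exact hbc.2.1
    refine (ih hb).trans (SimpleGraph.Adj.reachable ?_)
    exact SimpleGraph.induce_adj.2 (meshGraph_siteDomain_adj hbc.2.1 hbc.2.2 hbc.1)

/-- **A combinatorial Dobrushin datum on `ℤ²`**: a finite, nonempty, lattice-connected set of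
sites `S` and the subset `A ⊆ S` of sites to be wired (the remaining boundary sites form the
sacrificial dual-wired arc `B` of the tree's rendering, whose edges are deleted). This is the input
format of Duminil-Copin–Hongler–Nolin's Dobrushin domains ("a finite subgraph of `ℤ²` … with free
boundary conditions on `(ab)` and wired boundary conditions on `(ba)`", §2.2), up to the tree's
convention that the free arc is backed by a layer of `B`-sites.
[cite: DuminilCopinHonglerNolin2011, §2.2] -/
structure LatticeDobrushin where
  /-- The sites of the domain (including the wired sites and the sacrificial `B`-layer). -/
  S : Set (Site 2)
  /-- The sites to be wired (arc `A`). -/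
  A : Set (Site 2)
  /-- Finitely many sites. -/
  finite : S.Finite
  /-- The domain is connected through nearest-neighbour steps inside `S`. -/
  conn : ∀ x ∈ S, ∀ y ∈ S, Relation.ReflTransGen (SiteStep S) x y
  /-- Wired sites are sites. -/
  A_subset : A ⊆ S

namespace LatticeDobrushin

variable (L : LatticeDobrushin)

/-- The side `{z | ‖z - a‖_∞ ≤ 1/2, ‖z - c‖_∞ ≤ 1/2}` shared by the closed unit squares centred at
two neighbouring sites `a`, `c` (the dual edge of `{a, c}`, drawn in the plane). [folklore] -/
def sideSeg (a c : Site 2) : Set ℂ := {z | SupClose z a ∧ SupClose z c}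

/-- **The continuum arc `A`**: the union of the sides of the squares of wired sites `a ∈ A` facing
lattice neighbours outside `S` (the exposed sides of the wired sites). [folklore] -/
def exposedSides : Set ℂ := ⋃ a ∈ L.A, ⋃ c ∈ {c | (zdGraph 2).Adj a c ∧ c ∉ L.S}, sideSeg a c

/-- **The continuum Dobrushin data realising `L`**: the site-square domain of `S` at mesh `1`, the
arc `A` = the exposed sides of the wired sites, the arc `B` = the rest of the frontier.
[cite: DuminilCopinHonglerNolin2011, §2.2] -/
def toDobrushin : DiscreteDobrushin :=
  ⟨siteDomain L.S, 1, L.exposedSides, frontier (siteDomain L.S) \ L.exposedSides⟩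

/-- The domain of the realisation. [folklore] -/
@[simp] theorem toDobrushin_Ω : L.toDobrushin.Ω = siteDomain L.S := rfl

/-- The mesh of the realisation is `1`. [folklore] -/
@[simp] theorem toDobrushin_δ : L.toDobrushin.δ = 1 := rfl

/-- The arc `A` of the realisation. [folklore] -/
@[simp] theorem toDobrushin_arcA : L.toDobrushin.arcA = L.exposedSides := rfl

/-- The arc `B` of the realisation. [folklore] -/
@[simp] theorem toDobrushin_arcB : L.toDobrushin.arcB = frontier (siteDomain L.S) \ L.exposedSides := rfl

/-- The mesh vertices of the realisation are the sites. [folklore] -/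
theorem meshVertices_eq : meshVertices L.toDobrushin.Ω L.toDobrushin.δ = L.S :=
  meshVertices_siteDomain L.S

/-- The mesh vertex graph of the realisation is preconnected. [folklore] -/
theorem preconnected_meshVertexGraph : (meshVertexGraph (siteDomain L.S) 1).Preconnected := by
  intro a b
  have ha : a.1 ∈ L.S := (meshVertices_siteDomain L.S).subset a.2
  have hb : b.1 ∈ L.S := (meshVertices_siteDomain L.S).subset b.2
  exact reachable_of_reflTransGen a.2 (L.conn a.1 ha b.1 hb) b.2

/-- **The discrete domain of the realisation is `S`** ("the largest connected component of
`Ω ∩ δℤ²`" is everything, `S` being connected). [folklore] -/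
theorem meshDomain_eq : meshDomain L.toDobrushin.Ω L.toDobrushin.δ = L.S := by
  change meshDomain (siteDomain L.S) 1 = L.S
  refine Subset.antisymm ((meshDomain_subset_meshVertices _ _).trans (meshVertices_siteDomain L.S).subset)
    fun v hv => ?_
  have hv' : v ∈ meshVertices (siteDomain L.S) 1 := by rw [meshVertices_siteDomain]; exact hv
  have hsub := L.preconnected_meshVertexGraph.subsingleton_connectedComponent
  simp only [meshDomain, mem_iUnion, mem_image]
  refine ⟨(meshVertexGraph (siteDomain L.S) 1).connectedComponentMk ⟨v, hv'⟩, fun C' => ?_, ⟨v, hv'⟩, ?_, rfl⟩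
  · rw [Subsingleton.elim C' ((meshVertexGraph (siteDomain L.S) 1).connectedComponentMk ⟨v, hv'⟩)]
  · rw [SimpleGraph.ConnectedComponent.mem_supp_iff]

/-- The discrete domain is finite. [folklore] -/
theorem meshDomain_finite : (meshDomain L.toDobrushin.Ω L.toDobrushin.δ).Finite := by
  rw [L.meshDomain_eq]; exact L.finite

/-- A `Fintype` instance on the discrete domain of the realisation (needed by the FK measures of
`FermionicObservable.lean`). [folklore] -/
instance fintypeMeshDomain : Fintype (meshDomain L.toDobrushin.Ω L.toDobrushin.δ) :=
  L.meshDomain_finite.fintype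

/-- **The domain graph of the realisation is `ℤ²` induced on `S`.** [folklore] -/
theorem adj_iff {x y : Site 2} :
    (discreteDomainGraph L.toDobrushin.Ω L.toDobrushin.δ).Adj x y ↔ (zdGraph 2).Adj x y ∧ x ∈ L.S ∧ y ∈ L.S := by
  rw [discreteDomainGraph_adj_iff, L.meshDomain_eq]
  change (meshGraph (siteDomain L.S) 1).Adj x y ∧ _ ↔ _
  constructor
  · rintro ⟨h, hx, hy⟩
    exact ⟨meshGraph_le_zdGraph _ _ h, hx, hy⟩
  · rintro ⟨h, hx, hy⟩
    exact ⟨meshGraph_siteDomain_adj hx hy h, hx, hy⟩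

/-- Edges of the domain graph are edges of `ℤ²` with both endpoints in `S`. [folklore] -/
theorem mem_edgeSet_iff {x y : Site 2} :
    s(x, y) ∈ (discreteDomainGraph L.toDobrushin.Ω L.toDobrushin.δ).edgeSet ↔ (zdGraph 2).Adj x y ∧ x ∈ L.S ∧ y ∈ L.S :=
  L.adj_iff

/-- **A face is inner iff its four corners are sites of `S`.** [folklore] -/
theorem isInnerFace_iff {f : Site 2} : L.toDobrushin.IsInnerFace f ↔ ∀ v, IsCorner v f → v ∈ L.S := by
  constructor
  · intro h v hv
    have hadj := h v (cornerNeighbor v f 0) hv (isCorner_cornerNeighbor hv 0) (adj_cornerNeighbor hv 0)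
    exact (L.adj_iff.1 hadj).2.1
  · intro h v w hv hw hvw
    exact L.adj_iff.2 ⟨hvw, h v hv, h w hw⟩

/-- The four corners of a face, explicitly. [folklore] -/
theorem isInnerFace_iff' {f : Site 2} :
    L.toDobrushin.IsInnerFace f ↔ f ∈ L.S ∧ f + Pi.single 0 1 ∈ L.S ∧ f + Pi.single 1 1 ∈ L.S ∧
      f + Pi.single 0 1 + Pi.single 1 1 ∈ L.S := by
  rw [L.isInnerFace_iff]
  constructor
  · intro h
    exact ⟨h _ ((isCorner_iff _ _).2 (Or.inl rfl)), h _ ((isCorner_iff _ _).2 (Or.inr (Or.inl rfl))),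
      h _ ((isCorner_iff _ _).2 (Or.inr (Or.inr (Or.inl rfl)))), h _ ((isCorner_iff _ _).2 (Or.inr (Or.inr (Or.inr rfl))))⟩
  · rintro ⟨h1, h2, h3, h4⟩ v hv
    rcases (isCorner_iff v f).1 hv with rfl | rfl | rfl | rfl <;> assumption

/-- The four faces around a site all of whose eight neighbours (and itself) lie in `S` are inner. [folklore] -/
theorem isInnerFace_of_isCorner {x f : Site 2} (hx : ∀ y : Site 2, (∀ i, |y i - x i| ≤ 1) → y ∈ L.S)
    (hf : IsCorner x f) : L.toDobrushin.IsInnerFace f := by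
  rw [L.isInnerFace_iff]
  intro v hv
  refine hx v fun i => ?_
  rcases hf i with h | h <;> rcases hv i with h' | h' <;> rw [h, h'] <;> simp

/-- **The vertex boundary of the realisation**: sites of `S` with a lattice neighbour outside `S`. [folklore] -/
theorem mem_meshBoundary_iff {x : Site 2} :
    x ∈ meshBoundary L.toDobrushin.Ω L.toDobrushin.δ ↔ x ∈ L.S ∧ ∃ y, (zdGraph 2).Adj x y ∧ y ∉ L.S := by
  rw [_root_.Literature.Probability.LatticeModels.mem_meshBoundary_iff, L.meshDomain_eq]
  constructor
  · rintro ⟨hx, y, hxy, hn⟩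
    refine ⟨hx, y, hxy, fun hy => hn (L.adj_iff.2 ⟨hxy, hx, hy⟩)⟩
  · rintro ⟨hx, y, hxy, hy⟩
    exact ⟨hx, y, hxy, fun h => hy (L.adj_iff.1 h).2.2⟩

/-- A site of `S` with a lattice neighbour outside `S` is a boundary site. [folklore] -/
theorem mem_zdBoundary_of_adj {x y : Site 2} (hx : x ∈ L.S) (hxy : (zdGraph 2).Adj x y) (hy : y ∉ L.S) :
    x ∈ L.toDobrushin.zdBoundary :=
  L.toDobrushin.meshBoundary_subset_zdBoundary (L.mem_meshBoundary_iff.2 ⟨hx, y, hxy, hy⟩)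

/-- **Sites deep inside are not boundary sites**: if `x` and its eight lattice neighbours lie in
`S`, then `x ∉ zdBoundary` (all four faces at `x` are inner and all four neighbours are joined to
`x`). [folklore] -/
theorem not_mem_zdBoundary_of_forall {x : Site 2} (hx : ∀ y : Site 2, (∀ i, |y i - x i| ≤ 1) → y ∈ L.S) :
    x ∉ L.toDobrushin.zdBoundary := by
  rintro (h | ⟨y, -, -, f, hf, hxf, -⟩)
  · obtain ⟨-, y, hxy, hy⟩ := L.mem_meshBoundary_iff.1 h
    refine hy (hx y fun i => ?_)
    obtain ⟨j, hj | hj⟩ := (zdGraph_adj_iff x y).1 hxy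
    · subst hj; by_cases hij : i = j <;> simp [hij]
    · subst hj
      by_cases hij : i = j
      · subst hij; simp
      · simp [hij]
  · exact hf (L.isInnerFace_of_isCorner hx hxf)

/-- Boundary sites are sites. [folklore] -/
theorem mem_S_of_mem_zdBoundary {x : Site 2} (hx : x ∈ L.toDobrushin.zdBoundary) : x ∈ L.S := by
  have := L.toDobrushin.zdBoundary_subset_meshDomain hx
  rwa [L.meshDomain_eq] at this

end LatticeDobrushin

/-! ### Topology of the site-square domain -/

section Topology

variable {S : Set (Site 2)}

/-- The coordinates are continuous. [folklore] -/
theorem continuous_coordC (i : Fin 2) : Continuous fun z : ℂ => coordC z i := by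
  fin_cases i
  · exact Complex.continuous_re
  · exact Complex.continuous_im

/-- Closed unit squares are closed. [folklore] -/
theorem isClosed_setOf_supClose (x : Site 2) : IsClosed {z : ℂ | SupClose z x} := by
  have : {z : ℂ | SupClose z x} = ⋂ i, {z | |coordC z i - x i| ≤ 1 / 2} := by
    ext z; simp [SupClose]
  rw [this]
  exact isClosed_iInter fun i =>
    isClosed_le (((continuous_coordC i).sub continuous_const).abs) continuous_const

/-- The closed unit squares centred at lattice points form a locally finite family. [folklore] -/
theorem locallyFinite_supClose (T : Set (Site 2)) :
    LocallyFinite fun x : T => {z : ℂ | SupClose z x.1} := by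
  intro z
  refine ⟨ball z (1 / 2), ball_mem_nhds z (by norm_num), ?_⟩
  have hfin : (Set.univ.pi fun i : Fin 2 => Set.Icc ⌊coordC z i⌋ (⌊coordC z i⌋ + 1)).Finite :=
    Set.Finite.pi fun i => Set.finite_Icc _ _
  refine (hfin.preimage Subtype.val_injective.injOn).subset ?_
  rintro ⟨x, hxT⟩ ⟨w, hwx, hwz⟩
  simp only [mem_preimage, mem_pi, mem_univ, mem_Icc, forall_true_left]
  intro i
  rw [mem_ball] at hwz
  have h1 : |coordC w i - x i| ≤ 1 / 2 := hwx i
  have h2 : |coordC w i - coordC z i| ≤ dist w z := abs_coordC_sub_le_dist w z i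
  have h3 : |coordC z i - x i| < 1 := by
    rw [abs_le] at h1 h2; rw [abs_lt]; constructor <;> linarith
  rw [abs_lt] at h3
  have hf := Int.floor_le (coordC z i)
  have hf' := Int.lt_floor_add_one (coordC z i)
  constructor
  · have : (⌊coordC z i⌋ : ℝ) - 1 < x i := by linarith
    have : ⌊coordC z i⌋ - 1 < x i := by exact_mod_cast this
    omega
  · have : (x i : ℝ) < ⌊coordC z i⌋ + 2 := by linarith
    have : x i < ⌊coordC z i⌋ + 2 := by exact_mod_cast this
    omega

/-- **The site-square domain is open.** [folklore] -/
theorem isOpen_siteDomain (S : Set (Site 2)) : IsOpen (siteDomain S) := by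
  have h : siteDomain S = (⋃ x : {x : Site 2 // x ∉ S}, {z | SupClose z x.1})ᶜ := by
    ext z
    simp only [mem_siteDomain_iff, mem_compl_iff, mem_iUnion, mem_setOf_eq, not_exists]
    constructor
    · intro h x hx; exact x.2 (h x.1 hx)
    · intro h x hx; by_contra hxS; exact h ⟨x, hxS⟩ hx
  rw [h, isOpen_compl_iff]
  exact (locallyFinite_supClose {x | x ∉ S}).isClosed_iUnion fun x => isClosed_setOf_supClose x.1

/-- Points of the closure of the site-square domain of a finite `S` are sup-close to a site of `S`. [folklore] -/
theorem exists_supClose_of_mem_closure (hS : S.Finite) {z : ℂ} (hz : z ∈ closure (siteDomain S)) :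
    ∃ x ∈ S, SupClose z x := by
  have hsub : siteDomain S ⊆ ⋃ x ∈ S, {z | SupClose z x} := by
    intro w hw
    obtain ⟨x, hx⟩ := exists_supClose w
    exact mem_biUnion (hw x hx) hx
  have hcl : IsClosed (⋃ x ∈ S, {z : ℂ | SupClose z x}) := hS.isClosed_biUnion fun x _ => isClosed_setOf_supClose x
  have := (closure_minimal hsub hcl) hz
  simpa only [mem_iUnion, mem_setOf_eq, exists_prop] using this

/-- Points of the frontier of the site-square domain are sup-close to a lattice point outside `S`. [folklore] -/
theorem exists_supClose_not_mem_of_mem_frontier {z : ℂ} (hz : z ∈ frontier (siteDomain S)) :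
    ∃ x ∉ S, SupClose z x := by
  rw [(isOpen_siteDomain S).frontier_eq] at hz
  have h := hz.2
  simp only [mem_siteDomain_iff, not_forall, exists_prop] at h
  obtain ⟨x, hx, hxS⟩ := h
  exact ⟨x, hxS, hx⟩

/-- Frontier points are not points of the (open) site-square domain. [folklore] -/
theorem not_mem_siteDomain_of_mem_frontier {z : ℂ} (hz : z ∈ frontier (siteDomain S)) : z ∉ siteDomain S := by
  rw [(isOpen_siteDomain S).frontier_eq] at hz
  exact hz.2

/-- Two distinct lattice points differing only in the coordinate `i`, and there by at most one,
are neighbours in `ℤ²`. [folklore] -/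
theorem zdGraph_adj_of_coord {a b : Site 2} {i : Fin 2} (hne : a ≠ b) (hj : ∀ j, j ≠ i → a j = b j)
    (hi : |a i - b i| ≤ 1) : (zdGraph 2).Adj a b := by
  rw [zdGraph_adj_iff]
  refine ⟨i, ?_⟩
  have hii : a i ≠ b i := by
    intro h
    exact hne (funext fun j => by by_cases hji : j = i <;> [exact hji ▸ h; exact hj j hji])
  rw [abs_le] at hi
  rcases lt_or_gt_of_ne hii with h | h
  · left
    funext j
    by_cases hji : j = i
    · subst hji; simp; omega
    · simp [hji, hj j hji]
  · right
    funext j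
    by_cases hji : j = i
    · subst hji; simp; omega
    · simp [hji, hj j hji]

/-- **The frontier of the site-square domain consists of exposed sides**: every frontier point
lies on the side shared by the squares of a site `y ∈ S` and of a lattice neighbour `c ∉ S`. [folklore] -/
theorem frontier_siteDomain_subset (hS : S.Finite) {z : ℂ} (hz : z ∈ frontier (siteDomain S)) :
    ∃ y ∈ S, ∃ c ∉ S, (zdGraph 2).Adj y c ∧ SupClose z y ∧ SupClose z c := by
  obtain ⟨x, hxS, hx⟩ := exists_supClose_of_mem_closure hS (frontier_subset_closure hz)
  obtain ⟨x₀, hx₀S, hx₀⟩ := exists_supClose_not_mem_of_mem_frontier hz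
  -- the intermediate lattice point
  set x' : Site 2 := Function.update x 0 (x₀ 0) with hx'
  have hx'c : SupClose z x' := by
    intro i
    by_cases hi : i = 0
    · subst hi; rw [hx', Function.update_self]; exact hx₀ 0
    · rw [hx', Function.update_of_ne hi]; exact hx i
  have hd := abs_sub_le_one_of_supClose hx hx₀
  by_cases hx'S : x' ∈ S
  · -- step from `x'` to `x₀` in the coordinate `1`
    refine ⟨x', hx'S, x₀, hx₀S, ?_, hx'c, hx₀⟩
    refine zdGraph_adj_of_coord (i := 1) (fun h => hx₀S (h ▸ hx'S)) (fun j hj => ?_) ?_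
    · have : j = 0 := by omega
      subst this; rw [hx', Function.update_self]
    · rw [hx', Function.update_of_ne (by decide)]; exact hd 1
  · -- step from `x` to `x'` in the coordinate `0`
    refine ⟨x, hxS, x', hx'S, ?_, hx, hx'c⟩
    refine zdGraph_adj_of_coord (i := 0) (fun h => hx'S (h ▸ hxS)) (fun j hj => ?_) ?_
    · rw [hx', Function.update_of_ne hj]
    · rw [hx', Function.update_self]; exact hd 0

/-! ### Sides of squares: metric lemmas -/

/-- Neighbouring lattice points differ by at most one in each coordinate (local copy of
`abs_sub_le_one_of_zdGraph_two_adj` of `FKIsingAnnulusCrossingProofs.lean`, restated here to keep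
this geometric file free of the FK imports). [folklore] -/
theorem abs_sub_le_one_of_adj {a c : Site 2} (h : (zdGraph 2).Adj a c) (j : Fin 2) : |a j - c j| ≤ 1 := by
  obtain ⟨i, hi | hi⟩ := (zdGraph_adj_iff a c).1 h
  · subst hi; by_cases hji : j = i <;> simp [hji]
  · subst hi; by_cases hji : j = i <;> simp [hji]

/-- Neighbouring lattice points are at distance one. [folklore] -/
theorem dist_toComplex_of_adj {a c : Site 2} (h : (zdGraph 2).Adj a c) :
    dist (Site.toComplex a) (Site.toComplex c) = 1 := by
  have hsq : dist (Site.toComplex a) (Site.toComplex c) ^ 2 = 1 := by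
    rw [dist_sq_eq_sum_coordC]
    simp only [coordC_toComplex]
    obtain ⟨i, hi | hi⟩ := (zdGraph_adj_iff a c).1 h
    · subst hi; fin_cases i <;> simp
    · subst hi; fin_cases i <;> simp
  exact (pow_eq_one_iff_of_nonneg dist_nonneg two_ne_zero).1 hsq

/-- The midpoint of two neighbouring sites lies on the side shared by their squares. [folklore] -/
theorem midpoint_mem_sideSeg {a c : Site 2} (h : (zdGraph 2).Adj a c) :
    (Site.toComplex a + Site.toComplex c) / 2 ∈ LatticeDobrushin.sideSeg a c := by
  have key : ∀ i, coordC ((Site.toComplex a + Site.toComplex c) / 2) i = ((a i : ℝ) + c i) / 2 := by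
    intro i; fin_cases i <;> simp [coordC, Site.toComplex]
  constructor
  · intro i
    rw [key]
    have := abs_sub_le_one_of_adj h i
    have : |((a i - c i : ℤ) : ℝ)| ≤ 1 := by exact_mod_cast this
    push_cast at this
    rw [abs_le] at this ⊢; constructor <;> linarith
  · intro i
    rw [key]
    have := abs_sub_le_one_of_adj h i
    have : |((a i - c i : ℤ) : ℝ)| ≤ 1 := by exact_mod_cast this
    push_cast at this
    rw [abs_le] at this ⊢; constructor <;> linarith

/-- The midpoint of two neighbouring sites is at distance `1/2` from the first. [folklore] -/
theorem dist_midpoint_of_adj {a c : Site 2} (h : (zdGraph 2).Adj a c) :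
    dist (Site.toComplex a) ((Site.toComplex a + Site.toComplex c) / 2) = 1 / 2 := by
  have h1 := dist_toComplex_of_adj h
  rw [Complex.dist_eq] at h1 ⊢
  rw [show Site.toComplex a - (Site.toComplex a + Site.toComplex c) / 2 =
    (Site.toComplex a - Site.toComplex c) / 2 by ring, norm_div, h1]
  simp

/-- The coordinate across the side is pinned to the half-integer. [folklore] -/
theorem coordC_eq_of_mem_sideSeg {a : Site 2} {i : Fin 2} {z : ℂ}
    (hz : z ∈ LatticeDobrushin.sideSeg a (a + Pi.single i 1)) : coordC z i = a i + 1 / 2 := by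
  have h1 := hz.1 i
  have h2 := hz.2 i
  simp only [Pi.add_apply, Pi.single_eq_same, Int.cast_add, Int.cast_one] at h2
  rw [abs_le] at h1 h2
  linarith

/-- The arithmetic core of the far lemma. [folklore] -/
theorem half_le_sq_add_sq (bi bj ai aj : ℤ) (zi zj : ℝ) (hzi : zi = ai + 1 / 2) (hzj : |zj - aj| ≤ 1 / 2)
    (h0 : ¬ (bi = ai ∧ bj = aj)) (h1 : ¬ (bi = ai + 1 ∧ bj = aj)) :
    1 / 2 ≤ ((bi : ℝ) - zi) ^ 2 + ((bj : ℝ) - zj) ^ 2 := by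
  rw [abs_le] at hzj
  by_cases hj : bj = aj
  · have hbi : bi ≤ ai - 1 ∨ ai + 2 ≤ bi := by omega
    rcases hbi with h | h
    · have h' : (bi : ℝ) ≤ ai - 1 := by exact_mod_cast h
      nlinarith
    · have h' : (ai : ℝ) + 2 ≤ bi := by exact_mod_cast h
      nlinarith
  · have hbj : bj ≤ aj - 1 ∨ aj + 1 ≤ bj := by omega
    have hbi : bi ≤ ai ∨ ai + 1 ≤ bi := by omega
    have hsq_i : 1 / 4 ≤ ((bi : ℝ) - zi) ^ 2 := by
      rcases hbi with h | h
      · have h' : (bi : ℝ) ≤ ai := by exact_mod_cast h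
        nlinarith
      · have h' : (ai : ℝ) + 1 ≤ bi := by exact_mod_cast h
        nlinarith
    have hsq_j : 1 / 4 ≤ ((bj : ℝ) - zj) ^ 2 := by
      rcases hbj with h | h
      · have h' : (bj : ℝ) ≤ aj - 1 := by exact_mod_cast h
        nlinarith
      · have h' : (aj : ℝ) + 1 ≤ bj := by exact_mod_cast h
        nlinarith
    linarith

/-- `√2/2 ≤ d` as soon as `1/2 ≤ d²` for nonnegative `d`. [folklore] -/
theorem sqrt_two_div_two_le_of_sq {d : ℝ} (hd : 0 ≤ d) (h : 1 / 2 ≤ d ^ 2) : Real.sqrt 2 / 2 ≤ d := by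
  by_contra hlt
  push Not at hlt
  have hs := Real.sq_sqrt (show (0 : ℝ) ≤ 2 by norm_num)
  have hs' := Real.sqrt_nonneg 2
  nlinarith [mul_pos (sub_pos.2 hlt) (show 0 < Real.sqrt 2 / 2 + d by positivity)]

/-- **The far lemma**: a lattice point `b` which is not an endpoint of the edge `{a, a + eᵢ}` is at
distance `≥ √2/2` from the side dual to that edge. [folklore] -/
theorem sqrt_two_div_two_le_dist_of_mem_sideSeg_single {a b : Site 2} {i : Fin 2} {z : ℂ}
    (hz : z ∈ LatticeDobrushin.sideSeg a (a + Pi.single i 1)) (hb : b ≠ a) (hb' : b ≠ a + Pi.single i 1) :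
    Real.sqrt 2 / 2 ≤ dist (Site.toComplex b) z := by
  refine sqrt_two_div_two_le_of_sq dist_nonneg ?_
  have hzi := coordC_eq_of_mem_sideSeg hz
  rw [dist_sq_eq_sum_coordC]
  simp only [coordC_toComplex]
  have hne0 : ∀ j, j ≠ i → ¬ (b i = a i ∧ b j = a j) := by
    intro j hj ⟨h1, h2⟩
    exact hb (funext fun k => by
      by_cases hk : k = i
      · subst hk; exact h1
      · have : k = j := by omega
        subst this; exact h2)
  have hne1 : ∀ j, j ≠ i → ¬ (b i = a i + 1 ∧ b j = a j) := by
    intro j hj ⟨h1, h2⟩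
    exact hb' (funext fun k => by
      by_cases hk : k = i
      · subst hk; simp [h1]
      · have : k = j := by omega
        subst this; simp [hk, h2])
  fin_cases i
  · have hzj := hz.1 1
    have := half_le_sq_add_sq (b 0) (b 1) (a 0) (a 1) (coordC z 0) (coordC z 1) hzi hzj (hne0 1 (by decide)) (hne1 1 (by decide))
    simpa using this
  · have hzj := hz.1 0
    have := half_le_sq_add_sq (b 1) (b 0) (a 1) (a 0) (coordC z 1) (coordC z 0) hzi hzj (hne0 0 (by decide)) (hne1 0 (by decide))
    simp only [coordC_zero, coordC_one] at this ⊢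
    linarith

/-- Sides are symmetric in the two squares. [folklore] -/
theorem sideSeg_comm (a c : Site 2) : LatticeDobrushin.sideSeg a c = LatticeDobrushin.sideSeg c a := by
  ext z; exact and_comm

/-- **The far lemma**: a lattice point `b` off the edge `{a, c}` is at distance `≥ √2/2` from the
side shared by the squares of `a` and `c`. [folklore] -/
theorem sqrt_two_div_two_le_dist_of_mem_sideSeg {a b c : Site 2} (hac : (zdGraph 2).Adj a c) {z : ℂ}
    (hz : z ∈ LatticeDobrushin.sideSeg a c) (hb : b ≠ a) (hb' : b ≠ c) :
    Real.sqrt 2 / 2 ≤ dist (Site.toComplex b) z := by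
  obtain ⟨i, hi | hi⟩ := (zdGraph_adj_iff a c).1 hac
  · subst hi
    exact sqrt_two_div_two_le_dist_of_mem_sideSeg_single hz hb hb'
  · subst hi
    rw [sideSeg_comm] at hz
    exact sqrt_two_div_two_le_dist_of_mem_sideSeg_single hz hb' hb

/-- **Sides facing a missing neighbour are frontier**: if `a ∈ S` and its neighbour `c ∉ S`, the
side shared by their squares lies on the frontier of the site-square domain. [folklore] -/
theorem sideSeg_subset_frontier {a c : Site 2} (ha : a ∈ S) (hc : c ∉ S) :
    LatticeDobrushin.sideSeg a c ⊆ frontier (siteDomain S) := by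
  intro z hz
  rw [(isOpen_siteDomain S).frontier_eq]
  refine ⟨?_, fun h => hc (h c hz.2)⟩
  rw [Metric.mem_closure_iff]
  intro ε hε
  set t : ℝ := 1 - min ε 1 / 2 with ht
  have ht0 : 0 ≤ t := by
    have : min ε 1 ≤ 1 := min_le_right _ _
    rw [ht]; linarith
  have ht1 : t < 1 := by
    have : 0 < min ε 1 := lt_min hε one_pos
    rw [ht]; linarith
  set w : ℂ := Site.toComplex a + t • (z - Site.toComplex a) with hw
  have hwc : ∀ k, coordC w k - a k = t * (coordC z k - a k) := by
    intro k; rw [hw, coordC_add, coordC_smul, coordC_sub, coordC_toComplex]; ring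
  refine ⟨w, ?_, ?_⟩
  · -- `w` lies in the open square of `a`, hence in the domain
    intro x hx
    suffices x = a by rw [this]; exact ha
    funext k
    have h1 : |coordC w k - a k| < 1 / 2 := by
      rw [hwc, abs_mul, abs_of_nonneg ht0]
      have h2 : |coordC z k - a k| ≤ 1 / 2 := hz.1 k
      calc t * |coordC z k - ↑(a k)| ≤ t * (1 / 2) := by gcongr
        _ < 1 * (1 / 2) := by gcongr
        _ = 1 / 2 := one_mul _
    have h3 := hx k
    have h4 : |((x k : ℝ)) - a k| < 1 := by
      rw [abs_le] at h3; rw [abs_lt] at h1 ⊢; constructor <;> linarith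
    have h5 : |x k - a k| < 1 := by
      have : ((|x k - a k| : ℤ) : ℝ) < 1 := by rw [Int.cast_abs]; push_cast; exact h4
      exact_mod_cast this
    have := abs_lt.mp h5
    omega
  · -- `w` is `ε`-close to `z`
    rw [Complex.dist_eq]
    have hzw : z - w = (1 - t) • (z - Site.toComplex a) := by rw [hw]; module
    rw [hzw, norm_smul, Real.norm_of_nonneg (by linarith)]
    have hn : ‖z - Site.toComplex a‖ ≤ 1 := by
      calc ‖z - Site.toComplex a‖ ≤ |(z - Site.toComplex a).re| + |(z - Site.toComplex a).im| :=
            Complex.norm_le_abs_re_add_abs_im _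
        _ ≤ 1 / 2 + 1 / 2 := by
            gcongr
            · simpa [coordC] using hz.1 0
            · simpa [coordC] using hz.1 1
        _ = 1 := by norm_num
    have : 1 - t ≤ ε / 2 := by
      have : min ε 1 ≤ ε := min_le_left _ _
      rw [ht]; linarith
    calc (1 - t) * ‖z - Site.toComplex a‖ ≤ ε / 2 * 1 := by gcongr
      _ < ε := by linarith

end Topology

/-! ### The discrete arcs of the realisation -/

namespace LatticeDobrushin

variable (L : LatticeDobrushin)

/-- A site is *exposed* when one of its lattice neighbours lies outside `S` (it has an exposed
side). [folklore] -/
def Exposed (x : Site 2) : Prop := ∃ c, (zdGraph 2).Adj x c ∧ c ∉ L.S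

/-- Membership in the continuum arc `A`, unfolded. [folklore] -/
theorem mem_exposedSides_iff {z : ℂ} :
    z ∈ L.exposedSides ↔ ∃ a ∈ L.A, ∃ c, (zdGraph 2).Adj a c ∧ c ∉ L.S ∧ z ∈ sideSeg a c := by
  simp only [exposedSides, mem_iUnion, mem_setOf_eq, exists_prop]
  constructor
  · rintro ⟨a, ha, c, ⟨hac, hc⟩, hz⟩; exact ⟨a, ha, c, hac, hc, hz⟩
  · rintro ⟨a, ha, c, hac, hc, hz⟩; exact ⟨a, ha, c, ⟨hac, hc⟩, hz⟩

/-- The continuum arc `A` lies on the frontier of the domain. [folklore] -/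
theorem exposedSides_subset_frontier : L.exposedSides ⊆ frontier (siteDomain L.S) := by
  intro z hz
  obtain ⟨a, ha, c, -, hc, hz⟩ := L.mem_exposedSides_iff.1 hz
  exact sideSeg_subset_frontier (L.A_subset ha) hc hz

/-- The complement of the arc `B` in the frontier is the arc `A`. [folklore] -/
theorem frontier_diff_arcB : frontier L.toDobrushin.Ω \ L.toDobrushin.arcB = L.exposedSides := by
  rw [toDobrushin_Ω, toDobrushin_arcB, sdiff_sdiff_right_self, inter_eq_right]
  exact L.exposedSides_subset_frontier

/-- Membership in the discrete wired arc of the realisation. [folklore] -/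
theorem mem_zdArcA_iff {x : Site 2} :
    x ∈ L.toDobrushin.zdArcA ↔ x ∈ L.toDobrushin.zdBoundary ∧
      infDist (Site.toComplex x) L.exposedSides ≤
        infDist (Site.toComplex x) (frontier (siteDomain L.S) \ L.exposedSides) := by
  rw [DiscreteDobrushin.zdArcA, DiscreteDobrushin.mem_zdDiscreteArc_iff, toDobrushin_δ, meshPoint_one]
  rfl

/-- Membership in the discrete arc `B` of the realisation. [folklore] -/
theorem mem_zdArcB_iff {x : Site 2} :
    x ∈ L.toDobrushin.zdArcB ↔ x ∈ L.toDobrushin.zdBoundary ∧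
      infDist (Site.toComplex x) (frontier (siteDomain L.S) \ L.exposedSides) ≤
        infDist (Site.toComplex x) L.exposedSides := by
  rw [DiscreteDobrushin.zdArcB, DiscreteDobrushin.mem_zdDiscreteArc_iff, toDobrushin_δ, meshPoint_one,
    L.frontier_diff_arcB]
  rfl

/-- **The two discrete arcs cover the discrete boundary** (automatically, one of the two distance
comparisons holding at every site). [folklore] -/
theorem zdArcA_union_zdArcB : L.toDobrushin.zdArcA ∪ L.toDobrushin.zdArcB = L.toDobrushin.zdBoundary := by
  refine Subset.antisymm (union_subset L.toDobrushin.zdArcA_subset_zdBoundary L.toDobrushin.zdArcB_subset_zdBoundary)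
    fun x hx => ?_
  rcases le_total (infDist (Site.toComplex x) L.exposedSides)
    (infDist (Site.toComplex x) (frontier (siteDomain L.S) \ L.exposedSides)) with h | h
  · exact Or.inl (L.mem_zdArcA_iff.2 ⟨hx, h⟩)
  · exact Or.inr (L.mem_zdArcB_iff.2 ⟨hx, h⟩)

/-- A wired exposed site is within `1/2` of the arc `A` (the midpoint of its exposed side). [folklore] -/
theorem infDist_exposedSides_le {a c : Site 2} (ha : a ∈ L.A) (hac : (zdGraph 2).Adj a c) (hc : c ∉ L.S) :
    infDist (Site.toComplex a) L.exposedSides ≤ 1 / 2 := by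
  rw [← dist_midpoint_of_adj hac]
  exact infDist_le_dist_of_mem (L.mem_exposedSides_iff.2 ⟨a, ha, c, hac, hc, midpoint_mem_sideSeg hac⟩)

/-- **A wired site is at distance `≥ √2/2` from the arc `B`**: every frontier point off the exposed
sides of wired sites is on an exposed side of another site, to which the far lemma applies. [folklore] -/
theorem le_infDist_frontier_diff {a : Site 2} (ha : a ∈ L.A)
    (hne : (frontier (siteDomain L.S) \ L.exposedSides).Nonempty) :
    Real.sqrt 2 / 2 ≤ infDist (Site.toComplex a) (frontier (siteDomain L.S) \ L.exposedSides) := by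
  rw [le_infDist hne]
  rintro z ⟨hz, hzA⟩
  obtain ⟨y, hyS, c, hcS, hyc, hzy, hzc⟩ := frontier_siteDomain_subset L.finite hz
  have hya : a ≠ y := by
    rintro rfl
    exact hzA (L.mem_exposedSides_iff.2 ⟨a, ha, c, hyc, hcS, hzy, hzc⟩)
  have hca : a ≠ c := by rintro rfl; exact hcS (L.A_subset ha)
  exact sqrt_two_div_two_le_dist_of_mem_sideSeg hyc ⟨hzy, hzc⟩ hya hca

/-- **A non-wired site is at distance `≥ √2/2` from the arc `A`** (far lemma). [folklore] -/
theorem le_infDist_exposedSides {b : Site 2} (hbS : b ∈ L.S) (hbA : b ∉ L.A) (hne : L.exposedSides.Nonempty) :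
    Real.sqrt 2 / 2 ≤ infDist (Site.toComplex b) L.exposedSides := by
  rw [le_infDist hne]
  intro z hz
  obtain ⟨a, ha, c, hac, hc, hz⟩ := L.mem_exposedSides_iff.1 hz
  have hba : b ≠ a := by rintro rfl; exact hbA ha
  have hbc : b ≠ c := by rintro rfl; exact hc hbS
  exact sqrt_two_div_two_le_dist_of_mem_sideSeg hac hz hba hbc

/-- The midpoint of an exposed side of a non-wired site is a frontier point off the arc `A`. [folklore] -/
theorem midpoint_mem_frontier_diff {b c : Site 2} (hbS : b ∈ L.S) (hbA : b ∉ L.A) (hbc : (zdGraph 2).Adj b c)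
    (hc : c ∉ L.S) :
    (Site.toComplex b + Site.toComplex c) / 2 ∈ frontier (siteDomain L.S) \ L.exposedSides := by
  refine ⟨sideSeg_subset_frontier hbS hc (midpoint_mem_sideSeg hbc), fun h => ?_⟩
  obtain ⟨a, ha, c', hac', hc', hz⟩ := L.mem_exposedSides_iff.1 h
  have hba : b ≠ a := by rintro rfl; exact hbA ha
  have hbc' : b ≠ c' := by rintro rfl; exact hc' hbS
  have h1 := sqrt_two_div_two_le_dist_of_mem_sideSeg hac' hz hba hbc'
  rw [dist_midpoint_of_adj hbc] at h1
  have hs := Real.sq_sqrt (show (0 : ℝ) ≤ 2 by norm_num)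
  nlinarith [Real.sqrt_nonneg 2]

/-- A non-wired exposed site is within `1/2` of the arc `B`. [folklore] -/
theorem infDist_frontier_diff_le {b c : Site 2} (hbS : b ∈ L.S) (hbA : b ∉ L.A) (hbc : (zdGraph 2).Adj b c)
    (hc : c ∉ L.S) :
    infDist (Site.toComplex b) (frontier (siteDomain L.S) \ L.exposedSides) ≤ 1 / 2 := by
  rw [← dist_midpoint_of_adj hbc]
  exact infDist_le_dist_of_mem (L.midpoint_mem_frontier_diff hbS hbA hbc hc)

/-- `1/2 < √2/2`. [folklore] -/
theorem one_half_lt_sqrt_two_div_two : (1 : ℝ) / 2 < Real.sqrt 2 / 2 := by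
  have h : (1 : ℝ) < Real.sqrt 2 := by
    rw [show (1 : ℝ) = Real.sqrt 1 by simp]
    exact Real.sqrt_lt_sqrt (by norm_num) (by norm_num)
  linarith

/-- **No tie at an exposed wired site: it lies on the discrete wired arc …** (given that some
non-wired site is exposed, so that the arc `B` is nonempty). [folklore] -/
theorem mem_zdArcA_of_exposed {a : Site 2} (ha : a ∈ L.A) (hexp : L.Exposed a)
    (hB : ∃ b ∈ L.S, b ∉ L.A ∧ L.Exposed b) : a ∈ L.toDobrushin.zdArcA := by
  obtain ⟨c, hac, hc⟩ := hexp
  obtain ⟨b, hbS, hbA, c', hbc', hc'⟩ := hB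
  refine L.mem_zdArcA_iff.2 ⟨L.mem_zdBoundary_of_adj (L.A_subset ha) hac hc, ?_⟩
  have h1 := L.infDist_exposedSides_le ha hac hc
  have h2 := L.le_infDist_frontier_diff ha ⟨_, L.midpoint_mem_frontier_diff hbS hbA hbc' hc'⟩
  linarith [one_half_lt_sqrt_two_div_two]

/-- **… and not on the discrete arc `B`.** [folklore] -/
theorem not_mem_zdArcB_of_exposed {a : Site 2} (ha : a ∈ L.A) (hexp : L.Exposed a)
    (hB : ∃ b ∈ L.S, b ∉ L.A ∧ L.Exposed b) : a ∉ L.toDobrushin.zdArcB := by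
  obtain ⟨c, hac, hc⟩ := hexp
  obtain ⟨b, hbS, hbA, c', hbc', hc'⟩ := hB
  intro h
  have h0 := (L.mem_zdArcB_iff.1 h).2
  have h1 := L.infDist_exposedSides_le ha hac hc
  have h2 := L.le_infDist_frontier_diff ha ⟨_, L.midpoint_mem_frontier_diff hbS hbA hbc' hc'⟩
  linarith [one_half_lt_sqrt_two_div_two]

/-- **No tie at an exposed non-wired site: it lies on the discrete arc `B` …** (given that some
wired site is exposed, so that the arc `A` is nonempty). [folklore] -/
theorem mem_zdArcB_of_exposed {b : Site 2} (hbS : b ∈ L.S) (hbA : b ∉ L.A) (hexp : L.Exposed b)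
    (hA : ∃ a ∈ L.A, L.Exposed a) : b ∈ L.toDobrushin.zdArcB := by
  obtain ⟨c, hbc, hc⟩ := hexp
  obtain ⟨a, ha, c', hac', hc'⟩ := hA
  refine L.mem_zdArcB_iff.2 ⟨L.mem_zdBoundary_of_adj hbS hbc hc, ?_⟩
  have h1 := L.infDist_frontier_diff_le hbS hbA hbc hc
  have h2 := L.le_infDist_exposedSides hbS hbA
    ⟨_, L.mem_exposedSides_iff.2 ⟨a, ha, c', hac', hc', midpoint_mem_sideSeg hac'⟩⟩
  linarith [one_half_lt_sqrt_two_div_two]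

/-- **… and not on the discrete wired arc.** [folklore] -/
theorem not_mem_zdArcA_of_exposed {b : Site 2} (hbS : b ∈ L.S) (hbA : b ∉ L.A) (hexp : L.Exposed b)
    (hA : ∃ a ∈ L.A, L.Exposed a) : b ∉ L.toDobrushin.zdArcA := by
  obtain ⟨c, hbc, hc⟩ := hexp
  obtain ⟨a, ha, c', hac', hc'⟩ := hA
  intro h
  have h0 := (L.mem_zdArcA_iff.1 h).2
  have h1 := L.infDist_frontier_diff_le hbS hbA hbc hc
  have h2 := L.le_infDist_exposedSides hbS hbA
    ⟨_, L.mem_exposedSides_iff.2 ⟨a, ha, c', hac', hc', midpoint_mem_sideSeg hac'⟩⟩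
  linarith [one_half_lt_sqrt_two_div_two]

end LatticeDobrushin

/-! ### Domains all of whose sites are regular or exposed -/

namespace LatticeDobrushin

variable (L : LatticeDobrushin)

/-- A site is *regular* when it and its eight lattice neighbours lie in `S`. [folklore] -/
def Regular (x : Site 2) : Prop := ∀ y : Site 2, (∀ i, |y i - x i| ≤ 1) → y ∈ L.S

/-- Regular sites are sites. [folklore] -/
theorem Regular.mem {L : LatticeDobrushin} {x : Site 2} (h : L.Regular x) : x ∈ L.S :=
  h x fun i => by simp

/-- Regular sites are not exposed. [folklore] -/
theorem Regular.not_exposed {L : LatticeDobrushin} {x : Site 2} (h : L.Regular x) : ¬ L.Exposed x := by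
  rintro ⟨c, hxc, hc⟩
  refine hc (h c fun i => ?_)
  rw [abs_sub_comm]
  exact abs_sub_le_one_of_adj hxc i

/-- **The discrete boundary of a domain whose sites are all regular or exposed** is the set of
exposed sites. [folklore] -/
theorem zdBoundary_eq (hreg : ∀ x ∈ L.S, L.Regular x ∨ L.Exposed x) :
    L.toDobrushin.zdBoundary = {x | x ∈ L.S ∧ L.Exposed x} := by
  ext x
  constructor
  · intro hx
    have hxS := L.mem_S_of_mem_zdBoundary hx
    rcases hreg x hxS with h | h
    · exact absurd hx (L.not_mem_zdBoundary_of_forall h)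
    · exact ⟨hxS, h⟩
  · rintro ⟨hxS, c, hxc, hc⟩
    exact L.mem_zdBoundary_of_adj hxS hxc hc

/-- **The discrete wired arc of such a domain is the set of exposed wired sites** (both kinds of
exposed sites being present). [folklore] -/
theorem zdArcA_eq (hreg : ∀ x ∈ L.S, L.Regular x ∨ L.Exposed x) (hA : ∃ a ∈ L.A, L.Exposed a)
    (hB : ∃ b ∈ L.S, b ∉ L.A ∧ L.Exposed b) :
    L.toDobrushin.zdArcA = {x | x ∈ L.A ∧ L.Exposed x} := by
  ext x
  constructor
  · intro hx
    obtain ⟨hxS, hexp⟩ : x ∈ L.S ∧ L.Exposed x := by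
      have := L.toDobrushin.zdArcA_subset_zdBoundary hx
      rwa [L.zdBoundary_eq hreg] at this
    by_cases hxA : x ∈ L.A
    · exact ⟨hxA, hexp⟩
    · exact absurd hx (L.not_mem_zdArcA_of_exposed hxS hxA hexp hA)
  · rintro ⟨hxA, hexp⟩
    exact L.mem_zdArcA_of_exposed hxA hexp hB

/-- **The discrete arc `B` of such a domain is the set of exposed non-wired sites.** [folklore] -/
theorem zdArcB_eq (hreg : ∀ x ∈ L.S, L.Regular x ∨ L.Exposed x) (hA : ∃ a ∈ L.A, L.Exposed a)
    (hB : ∃ b ∈ L.S, b ∉ L.A ∧ L.Exposed b) :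
    L.toDobrushin.zdArcB = {x | x ∈ L.S ∧ x ∉ L.A ∧ L.Exposed x} := by
  ext x
  constructor
  · intro hx
    obtain ⟨hxS, hexp⟩ : x ∈ L.S ∧ L.Exposed x := by
      have := L.toDobrushin.zdArcB_subset_zdBoundary hx
      rwa [L.zdBoundary_eq hreg] at this
    by_cases hxA : x ∈ L.A
    · exact absurd hx (L.not_mem_zdArcB_of_exposed hxA hexp hB)
    · exact ⟨hxS, hxA, hexp⟩
  · rintro ⟨hxS, hxA, hexp⟩
    exact L.mem_zdArcB_of_exposed hxS hxA hexp hA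

/-- For such a domain the two discrete arcs are disjoint (no ties). [folklore] -/
theorem disjoint_zdArcA_zdArcB (hreg : ∀ x ∈ L.S, L.Regular x ∨ L.Exposed x) (hA : ∃ a ∈ L.A, L.Exposed a)
    (hB : ∃ b ∈ L.S, b ∉ L.A ∧ L.Exposed b) :
    Disjoint L.toDobrushin.zdArcA L.toDobrushin.zdArcB := by
  rw [L.zdArcA_eq hreg hA hB, L.zdArcB_eq hreg hA hB, Set.disjoint_left]
  rintro x ⟨hxA, -⟩ ⟨-, hxA', -⟩
  exact hxA' hxA

/-- **The `A`–`B` edges of such a domain**: lattice edges joining an exposed wired site to an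
exposed non-wired site of `S`. [folklore] -/
theorem mem_zdABEdges_iff (hreg : ∀ x ∈ L.S, L.Regular x ∨ L.Exposed x) (hA : ∃ a ∈ L.A, L.Exposed a)
    (hB : ∃ b ∈ L.S, b ∉ L.A ∧ L.Exposed b) {x y : Site 2} :
    s(x, y) ∈ L.toDobrushin.zdABEdges ↔ (zdGraph 2).Adj x y ∧
      ((x ∈ L.A ∧ L.Exposed x ∧ y ∈ L.S ∧ y ∉ L.A ∧ L.Exposed y) ∨
        (y ∈ L.A ∧ L.Exposed y ∧ x ∈ L.S ∧ x ∉ L.A ∧ L.Exposed x)) := by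
  rw [DiscreteDobrushin.mem_zdABEdges_iff, L.mem_edgeSet_iff, L.zdArcA_eq hreg hA hB, L.zdArcB_eq hreg hA hB]
  simp only [Sym2.mem_iff, mem_setOf_eq]
  constructor
  · rintro ⟨⟨hadj, hxS, hyS⟩, ⟨a, ha | ha, haA, haexp⟩, ⟨b, hb | hb, hbS, hbA, hbexp⟩⟩ <;> subst ha <;> subst hb
    · exact absurd haA hbA
    · exact ⟨hadj, Or.inl ⟨haA, haexp, hbS, hbA, hbexp⟩⟩
    · exact ⟨hadj, Or.inr ⟨haA, haexp, hbS, hbA, hbexp⟩⟩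
    · exact absurd haA hbA
  · rintro ⟨hadj, ⟨hxA, hxe, hyS, hyA, hye⟩ | ⟨hyA, hye, hxS, hxA, hxe⟩⟩
    · exact ⟨⟨hadj, L.A_subset hxA, hyS⟩, ⟨x, Or.inl rfl, hxA, hxe⟩, ⟨y, Or.inr rfl, hyS, hyA, hye⟩⟩
    · exact ⟨⟨hadj, hxS, L.A_subset hyA⟩, ⟨y, Or.inr rfl, hyA, hye⟩, ⟨x, Or.inl rfl, hxS, hxA, hxe⟩⟩

/-- **Admissibility of the realisation**, reduced to the combinatorial conditions: the two discrete
arcs are given as computed, both kinds of exposed sites exist, there are exactly two `A`–`B` edges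
and each is a side of exactly one inner face. [folklore] -/
theorem isZdAdmissible_of (hdisj : Disjoint L.toDobrushin.zdArcA L.toDobrushin.zdArcB)
    (hA : L.toDobrushin.zdArcA.Nonempty) (hB : L.toDobrushin.zdArcB.Nonempty)
    (hcard : L.toDobrushin.zdABEdges.ncard = 2)
    (hinner : ∀ e ∈ L.toDobrushin.zdABEdges, ∃! f, L.toDobrushin.IsInnerFace f ∧ ∀ x ∈ e, IsCorner x f) :
    L.toDobrushin.IsZdAdmissible where
  isBounded := isBounded_siteDomain L.finite
  delta_pos := one_pos
  zdArcA_nonempty := hA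
  zdArcB_nonempty := hB
  disjoint := hdisj
  zdBoundary_subset := (L.zdArcA_union_zdArcB).symm.subset
  ncard_zdABEdges_eq_two := hcard
  zdABEdges_inner := hinner

end LatticeDobrushin

/-! ### Concave corners: boundary sites without an exposed side -/

namespace LatticeDobrushin

variable (L : LatticeDobrushin)

/-- `c` is a diagonal neighbour of `x` in `ℤ²`. [folklore] -/
def Diag (x c : Site 2) : Prop := ∀ k, |c k - x k| = 1

/-- `y` is a *flank* of `x`: a lattice neighbour of `x` having a lattice neighbour `c ∉ S` diagonal
to `x` — the situation at a concave corner of `S`, where the face with corners `x, y, c` is not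
inner although `x` has no exposed side. [folklore] -/
def IsFlank (x y : Site 2) : Prop := (zdGraph 2).Adj x y ∧ ∃ c ∉ L.S, (zdGraph 2).Adj y c ∧ Diag x c

variable {L}

/-- Diagonal neighbours are at distance `√2`. [folklore] -/
theorem dist_toComplex_of_diag {x c : Site 2} (h : Diag x c) : dist (Site.toComplex x) (Site.toComplex c) = Real.sqrt 2 := by
  have hsq : dist (Site.toComplex x) (Site.toComplex c) ^ 2 = 2 := by
    rw [dist_sq_eq_sum_coordC]
    simp only [coordC_toComplex]
    have h0 : ((x 0 : ℝ) - c 0) ^ 2 = 1 := by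
      have := h 0
      have : |((c 0 - x 0 : ℤ) : ℝ)| = 1 := by exact_mod_cast this
      push_cast at this
      rw [← sq_abs, abs_sub_comm, this, one_pow]
    have h1 : ((x 1 : ℝ) - c 1) ^ 2 = 1 := by
      have := h 1
      have : |((c 1 - x 1 : ℤ) : ℝ)| = 1 := by exact_mod_cast this
      push_cast at this
      rw [← sq_abs, abs_sub_comm, this, one_pow]
    rw [h0, h1]; norm_num
  rw [← Real.sqrt_sq (dist_nonneg (x := Site.toComplex x) (y := Site.toComplex c)), hsq]

/-- The corner point between `x` and a diagonal neighbour `c` is at distance `√2/2` from `x`. [folklore] -/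
theorem dist_cornerPoint_of_diag {x c : Site 2} (h : Diag x c) :
    dist (Site.toComplex x) ((Site.toComplex x + Site.toComplex c) / 2) = Real.sqrt 2 / 2 := by
  have h1 := dist_toComplex_of_diag h
  rw [Complex.dist_eq] at h1 ⊢
  rw [show Site.toComplex x - (Site.toComplex x + Site.toComplex c) / 2 =
    (Site.toComplex x - Site.toComplex c) / 2 by ring, norm_div, h1]
  simp

/-- **The corner point lies on the side between a flank and the missing diagonal**: for a lattice
neighbour `y` of `x` adjacent to the diagonal neighbour `c` of `x`, the midpoint of `x` and `c` lies
on the side shared by the squares of `y` and `c`. [folklore] -/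
theorem cornerPoint_mem_sideSeg {x y c : Site 2} (hxy : (zdGraph 2).Adj x y) (hyc : (zdGraph 2).Adj y c)
    (hd : Diag x c) : (Site.toComplex x + Site.toComplex c) / 2 ∈ sideSeg y c := by
  have key : ∀ i, coordC ((Site.toComplex x + Site.toComplex c) / 2) i = ((x i : ℝ) + c i) / 2 := by
    intro i; fin_cases i <;> simp [coordC, Site.toComplex]
  constructor
  · intro k
    rw [key]
    have h1 := abs_sub_le_one_of_adj hxy k
    have h2 := abs_sub_le_one_of_adj hyc k
    have h3 := hd k
    -- `y k` is `x k` or `c k`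
    have hyk : y k = x k ∨ y k = c k := by
      rw [abs_le] at h1 h2
      rcases abs_eq (show (0 : ℤ) ≤ 1 by norm_num) |>.1 h3 with h | h <;> omega
    rcases hyk with h | h
    · rw [h]
      have : |((c k - x k : ℤ) : ℝ)| = 1 := by exact_mod_cast h3
      push_cast at this
      rw [show ((x k : ℝ) + c k) / 2 - x k = (c k - x k) / 2 by ring, abs_div, this]; norm_num
    · rw [h]
      have : |((c k - x k : ℤ) : ℝ)| = 1 := by exact_mod_cast h3
      push_cast at this
      rw [show ((x k : ℝ) + c k) / 2 - c k = -((c k - x k) / 2) by ring, abs_neg, abs_div, this]; norm_num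
  · intro k
    rw [key]
    have h3 := hd k
    have : |((c k - x k : ℤ) : ℝ)| = 1 := by exact_mod_cast h3
    push_cast at this
    rw [show ((x k : ℝ) + c k) / 2 - c k = -((c k - x k) / 2) by ring, abs_neg, abs_div, this]; norm_num

/-- **Classification of the frontier near a site with no exposed side.** If `x ∈ S` has its four
lattice neighbours in `S`, every point of an exposed side `sideSeg a c'` (`c' ∉ S` a lattice
neighbour of `a`) at distance `< 3/2` from `x` has `a` a flank of `x`, with missing diagonal `c'`. [folklore] -/
theorem isFlank_of_dist_lt {x a c' : Site 2} (hxS : x ∈ L.S) (h4 : ∀ y, (zdGraph 2).Adj x y → y ∈ L.S)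
    (hc' : c' ∉ L.S) (hac' : (zdGraph 2).Adj a c') {z : ℂ} (hz : z ∈ sideSeg a c')
    (hdist : dist (Site.toComplex x) z < 3 / 2) : L.IsFlank x a ∧ Diag x c' := by
  -- all coordinates of `a` and `c'` are within one of those of `x`
  have hco : ∀ (w : Site 2), SupClose z w → ∀ k, |w k - x k| ≤ 1 := by
    intro w hw k
    have h1 : |coordC z k - w k| ≤ 1 / 2 := hw k
    have h2 : |coordC (Site.toComplex x) k - coordC z k| ≤ dist (Site.toComplex x) z := abs_coordC_sub_le_dist _ _ k
    rw [coordC_toComplex] at h2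
    have h3 : |((w k : ℝ)) - x k| < 2 := by
      rw [abs_le] at h1 h2; rw [abs_lt]; constructor <;> linarith
    have h4' : |w k - x k| < 2 := by
      have : ((|w k - x k| : ℤ) : ℝ) < 2 := by rw [Int.cast_abs]; push_cast; exact h3
      exact_mod_cast this
    omega
  have ha1 := hco a hz.1
  have hc1 := hco c' hz.2
  have hcx : c' ≠ x := by rintro rfl; exact hc' hxS
  have hnadj : ¬ (zdGraph 2).Adj x c' := fun h => hc' (h4 c' h)
  -- `c'` is diagonal to `x`
  have hdiag : Diag x c' := by
    intro k
    have hk := hc1 k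
    by_contra hne
    have hk0 : c' k = x k := by
      have : |c' k - x k| < 1 := lt_of_le_of_ne hk hne
      have := abs_lt.mp this
      omega
    refine hnadj (zdGraph_adj_of_coord (i := 1 - k) hcx.symm (fun j hj => ?_) ?_)
    · have : j = k := by omega
      subst this; exact hk0.symm
    · rw [abs_sub_comm]; exact hc1 _
  -- `a` is a lattice neighbour of `x`
  obtain ⟨i, hi⟩ : ∃ i : Fin 2, a i ≠ c' i ∧ ∀ j, j ≠ i → a j = c' j := by
    obtain ⟨i, hi | hi⟩ := (zdGraph_adj_iff a c').1 hac'
    · refine ⟨i, ?_, fun j hj => ?_⟩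
      · rw [hi]; simp
      · rw [hi]; simp [hj]
    · refine ⟨i, ?_, fun j hj => ?_⟩
      · rw [hi]; simp
      · rw [hi]; simp [hj]
  have hai : a i = x i := by
    have h1 := ha1 i
    have h2 := hdiag i
    have h3 := abs_sub_le_one_of_adj hac' i
    rw [abs_le] at h1 h3
    rcases abs_eq (show (0 : ℤ) ≤ 1 by norm_num) |>.1 h2 with h | h <;> omega
  have hxa : (zdGraph 2).Adj x a := by
    refine zdGraph_adj_of_coord (i := 1 - i) ?_ (fun j hj => ?_) ?_
    · rintro rfl
      -- then `c'` would be adjacent to `x`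
      exact hnadj hac'
    · have : j = i := by omega
      subst this; exact hai.symm
    · have h1 := hi.2 (1 - i) (by omega)
      rw [abs_sub_comm, h1]; exact hc1 _
  exact ⟨⟨hxa, c', hc', hac', hdiag⟩, hdiag⟩

/-- `√2/2 < 3/2`. [folklore] -/
theorem sqrt_two_div_two_lt : Real.sqrt 2 / 2 < 3 / 2 := by
  have : Real.sqrt 2 < 3 := by
    rw [show (3 : ℝ) = Real.sqrt 9 by rw [show (9 : ℝ) = 3 ^ 2 by norm_num, Real.sqrt_sq (by norm_num)]]
    exact Real.sqrt_lt_sqrt (by norm_num) (by norm_num)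
  linarith

variable (L)

/-- **A concave corner all of whose flanks are wired lies on the discrete wired arc** (and is at
distance `√2/2` from the continuum arc `A`, `≥ 3/2` from the arc `B`). [folklore] -/
theorem mem_zdArcA_of_flanks {x : Site 2} (hx : x ∈ L.toDobrushin.zdBoundary)
    (h4 : ∀ y, (zdGraph 2).Adj x y → y ∈ L.S) (hflA : ∀ y, L.IsFlank x y → y ∈ L.A)
    (hex : ∃ y, L.IsFlank x y) (hB : ∃ b ∈ L.S, b ∉ L.A ∧ L.Exposed b) :
    x ∈ L.toDobrushin.zdArcA ∧ x ∉ L.toDobrushin.zdArcB := by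
  have hxS := L.mem_S_of_mem_zdBoundary hx
  obtain ⟨y, hy⟩ := hex
  obtain ⟨hxy, c, hcS, hyc, hdiag⟩ := hy
  obtain ⟨b, hbS, hbA, c'', hbc'', hc''⟩ := hB
  -- the corner point towards `c` is on the arc `A`
  have hup : infDist (Site.toComplex x) L.exposedSides ≤ Real.sqrt 2 / 2 := by
    rw [← dist_cornerPoint_of_diag hdiag]
    exact infDist_le_dist_of_mem
      (L.mem_exposedSides_iff.2 ⟨y, hflA y ⟨hxy, c, hcS, hyc, hdiag⟩, c, hyc, hcS, cornerPoint_mem_sideSeg hxy hyc hdiag⟩)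
  -- every frontier point off the arc `A` is far
  have hlow : 3 / 2 ≤ infDist (Site.toComplex x) (frontier (siteDomain L.S) \ L.exposedSides) := by
    rw [le_infDist ⟨_, L.midpoint_mem_frontier_diff hbS hbA hbc'' hc''⟩]
    rintro z ⟨hz, hzA⟩
    by_contra hlt
    push Not at hlt
    obtain ⟨a, haS, c', hc'S, hac', hza, hzc'⟩ := frontier_siteDomain_subset L.finite hz
    have hfl := (isFlank_of_dist_lt hxS h4 hc'S hac' ⟨hza, hzc'⟩ hlt).1
    exact hzA (L.mem_exposedSides_iff.2 ⟨a, hflA a hfl, c', hac', hc'S, hza, hzc'⟩)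
  refine ⟨L.mem_zdArcA_iff.2 ⟨hx, ?_⟩, fun h => ?_⟩
  · linarith [sqrt_two_div_two_lt]
  · have := (L.mem_zdArcB_iff.1 h).2
    linarith [sqrt_two_div_two_lt]

/-- **A concave corner none of whose flanks is wired lies on the discrete arc `B`.** [folklore] -/
theorem mem_zdArcB_of_flanks {x : Site 2} (hx : x ∈ L.toDobrushin.zdBoundary)
    (h4 : ∀ y, (zdGraph 2).Adj x y → y ∈ L.S) (hflB : ∀ y, L.IsFlank x y → y ∉ L.A)
    (hex : ∃ y, L.IsFlank x y) (hA : ∃ a ∈ L.A, L.Exposed a) :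
    x ∈ L.toDobrushin.zdArcB ∧ x ∉ L.toDobrushin.zdArcA := by
  have hxS := L.mem_S_of_mem_zdBoundary hx
  obtain ⟨y, hy⟩ := hex
  obtain ⟨hxy, c, hcS, hyc, hdiag⟩ := hy
  obtain ⟨a₀, ha₀, c₀, hac₀, hc₀⟩ := hA
  have hyS : y ∈ L.S := h4 y hxy
  -- the corner point towards `c` is a frontier point off the arc `A`
  have hup : infDist (Site.toComplex x) (frontier (siteDomain L.S) \ L.exposedSides) ≤ Real.sqrt 2 / 2 := by
    rw [← dist_cornerPoint_of_diag hdiag]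
    refine infDist_le_dist_of_mem ⟨sideSeg_subset_frontier hyS hcS (cornerPoint_mem_sideSeg hxy hyc hdiag), fun h => ?_⟩
    obtain ⟨a, ha, c', hac', hc', hz⟩ := L.mem_exposedSides_iff.1 h
    have hlt : dist (Site.toComplex x) ((Site.toComplex x + Site.toComplex c) / 2) < 3 / 2 := by
      rw [dist_cornerPoint_of_diag hdiag]; exact sqrt_two_div_two_lt
    exact hflB a (isFlank_of_dist_lt hxS h4 hc' hac' hz hlt).1 ha
  have hlow : 3 / 2 ≤ infDist (Site.toComplex x) L.exposedSides := by
    rw [le_infDist ⟨_, L.mem_exposedSides_iff.2 ⟨a₀, ha₀, c₀, hac₀, hc₀, midpoint_mem_sideSeg hac₀⟩⟩]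
    intro z hz
    by_contra hlt
    push Not at hlt
    obtain ⟨a, ha, c', hac', hc', hz⟩ := L.mem_exposedSides_iff.1 hz
    exact hflB a (isFlank_of_dist_lt hxS h4 hc' hac' hz hlt).1 ha
  refine ⟨L.mem_zdArcB_iff.2 ⟨hx, ?_⟩, fun h => ?_⟩
  · linarith [sqrt_two_div_two_lt]
  · have := (L.mem_zdArcA_iff.1 h).2
    linarith [sqrt_two_div_two_lt]

/-- A site of `S` lying on an edge of `S` which is a side of an inner face and of a non-inner face is
a boundary site (the face-boundary half of `zdBoundary`). [folklore] -/
theorem mem_zdBoundary_of_faces {x y f g : Site 2} (hxS : x ∈ L.S) (hyS : y ∈ L.S) (hxy : (zdGraph 2).Adj x y)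
    (hf : L.toDobrushin.IsInnerFace f) (hxf : IsCorner x f) (hyf : IsCorner y f)
    (hg : ¬ L.toDobrushin.IsInnerFace g) (hxg : IsCorner x g) (hyg : IsCorner y g) :
    x ∈ L.toDobrushin.zdBoundary :=
  Or.inr ⟨y, L.adj_iff.2 ⟨hxy, hxS, hyS⟩, ⟨f, hf, hxf, hyf⟩, ⟨g, hg, hxg, hyg⟩⟩

end LatticeDobrushin

end Literature.Probability.LatticeModels
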